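/-
Copyright (c) 2026. All rights reserved.
Released under Apache 2.0 license as described in the file LICENSE.
Authors: abc-iut cell, wave-4 seat abc-iut-w4-d059 (proof-only; (AI3) for the produced data: the two-sided
`edge` / `edgeFix` field texts of `ArithLevelData` from the pair form `ArithBrGpStabilizer.lean`).
-/
import Literature.AnabelianGeometry.SemiGraphs.ArithBrGpStabilizer
import Literature.AnabelianGeometry.SemiGraphs.TreeSystemFixedPair
import Literature.AnabelianGeometry.SemiGraphs.TreeFixedPairProofs
import HarnessLib

/-!
# [SemiAnbd] Thm 5.4 (i) p. 66 / §5 p. 65: the edge-like subgroups of the PRODUCED decomposition data are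
# exactly the stabilisers of eventual compatible edge systems — fields (AI3) `edge` / `edgeFix` (proof-only)

Mochizuki, *Semi-graphs of anabelioids*, Publ. RIMS **42** (2006), §5 p. 65 and the proof of Thm 5.4 (i)
p. 66 ("entirely similar to … Theorem 3.7 (iii)", whose proof p. 41 with the author's Comments (6) runs on
compatible systems of vertices and edges of the trees `T_j`). [cite: MochizukiSemiAnbd2006, Thm 5.4 (i), p. 66]

PROOF-ONLY sequel to `ArithBrGpStabilizer.lean` (abc-iut cell, sub-DAG SemiAnbd-Thm54, the (AI3) edge twin
of row T54-0b, seat abc-iut-w4-d059; producer abc-iut-w4-d053).  No definition, no new named fact.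

* Tree combinatorics `edgeSystem_fixed_iff_ends_fixed`: for an eventual compatible system of tree edges
  `ε` given WITH its end-point data (branches `c j`, `c' j` of `ε j` at the compatible vertex systems
  `x₁ j ≠ x₂ j` — the shape of the field `edgeFix` of abc-iut-w4-d053's `ArithLevelData`), an element
  fixes every `ε j` together with its branches IFF it fixes `x₁` and `x₂` (in a tree two distinct
  vertices are joined by at most one edge, `SemiGraph.edge_unique_of_abuts`; a fixed edge at a fixed
  vertex has fixed branches, `SemiGraph.branchMap_eq_self_of_fixed`); and `exists_ends_translate`: end-point
  data translate along the action.
* `edgeFix_decompositionDataOfChart` / `edge_decompositionDataOfChart_of_ends`: the two-sided field texts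
  (AI3) of `ArithLevelData` for `D := decompositionDataOfChart R ι` — every edge-like subgroup of `D` IS the
  full stabiliser of an eventual compatible edge system with end-point data, and conversely every such
  stabiliser is edge-like for `D` — from `mem_arithBrGp_iff_fixes_pair`.  Inputs (all geometric, for the
  restricted action `n ↦ ρ j (ι n)`): the vertex dictionary (`hstabN`, `huniqN`), the pair dictionary
  (`hEstabN`, `hErigid`, `hEinj`) for an abstract action-invariant adjacency `Adj` implying end-point
  data (`hAdjEnds`; and implied by them, `hEndsAdj`), reference pro-vertices / pro-branches `X v`, `Y b`
  of the chosen representatives `R.Hv v`, `R.Hb b` (`hX`, `hY`), and (`hEtrans`) transitivity of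
  `Π^temp_𝔾` on the pro-branches above each branch of `𝔾` (Kőnig on the finite level-wise transporters).

Nothing here takes a side on [IUTchIII] Cor. 3.12; typed ≠ proved elsewhere.
-/

namespace Literature.AnabelianGeometry.SemiGraphs

open CategoryTheory
open scoped Pointwise

universe v u u' w

section Generic

variable {Gtp : Type u'} [Group Gtp] {J : Type v} [Preorder J] (T : J → SemiGraph.{w})
  (ρ : ∀ j, Gtp →* Aut (T j)) (f : ∀ ⦃i j : J⦄, i ≤ j → (T j ⟶ T i))

/-! ### Tree combinatorics: an edge system with end-points is fixed iff its end-points are -/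

/-- **An eventual compatible system of tree edges, given with its end-point data, is fixed (edges and
their branches) iff its two end-point vertex systems are fixed.**  (⇒) a fixed branch has a fixed
abutment vertex, and below the initial level the end-points are images under the equivariant
transitions; (⇐) in a tree two distinct vertices are joined by at most one edge, and an edge fixed
together with an end-vertex has fixed branches. [cite: MochizukiSemiAnbd2006, Thm 3.7(iii) p.41] -/
theorem edgeSystem_fixed_iff_ends_fixed [IsDirectedOrder J] (hT : ∀ j, (T j).IsTree)
    (hequiv : ∀ ⦃i j : J⦄ (h : i ≤ j) (g : Gtp) (z : (T j).Vertex),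
      (f h).vertexMap ((ρ j g).hom.vertexMap z) = (ρ i g).hom.vertexMap ((f h).vertexMap z))
    {i : J} {ε : ∀ j : {j : J // i ≤ j}, (T j.1).Edge} {c c' : ∀ j : {j : J // i ≤ j}, (T j.1).Branch}
    {x₁ x₂ : ∀ j, (T j).Vertex}
    (hx₁ : ∀ ⦃i' j : J⦄ (h : i' ≤ j), (f h).vertexMap (x₁ j) = x₁ i')
    (hx₂ : ∀ ⦃i' j : J⦄ (h : i' ≤ j), (f h).vertexMap (x₂ j) = x₂ i')
    (hends : ∀ j, x₁ j.1 ≠ x₂ j.1 ∧ (T j.1).edgeOf (c j) = ε j ∧ (T j.1).edgeOf (c' j) = ε j ∧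
      (T j.1).abuts (c j) = some (x₁ j.1) ∧ (T j.1).abuts (c' j) = some (x₂ j.1))
    (g : Gtp) :
    (∀ j, (ρ j.1 g).hom.edgeMap (ε j) = ε j ∧
        ∀ b : (T j.1).Branch, (T j.1).edgeOf b = ε j → (ρ j.1 g).hom.branchMap b = b) ↔
      (∀ j, (ρ j g).hom.vertexMap (x₁ j) = x₁ j) ∧ ∀ j, (ρ j g).hom.vertexMap (x₂ j) = x₂ j := by
  constructor
  · intro h
    -- an end-point system is fixed: at levels `≥ i` via its branch, everywhere via the transitions
    have key : ∀ (x : ∀ j, (T j).Vertex) (cc : ∀ j : {j : J // i ≤ j}, (T j.1).Branch),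
        (∀ ⦃i' j : J⦄ (h : i' ≤ j), (f h).vertexMap (x j) = x i') →
        (∀ j, (T j.1).edgeOf (cc j) = ε j ∧ (T j.1).abuts (cc j) = some (x j.1)) →
        ∀ j, (ρ j g).hom.vertexMap (x j) = x j := by
      intro x cc hx hcc j
      obtain ⟨k, hik, hjk⟩ := exists_ge_ge i j
      have hk : (ρ k g).hom.vertexMap (x k) = x k := by
        obtain ⟨hce, hca⟩ := hcc ⟨k, hik⟩
        have hb := (h ⟨k, hik⟩).2 (cc ⟨k, hik⟩) hce
        have hab := (ρ k g).hom.abuts_branchMap (cc ⟨k, hik⟩) (x k) hca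
        rw [hb, hca] at hab
        exact (Option.some.inj hab).symm
      rw [← hx hjk, ← hequiv hjk g (x k), hk]
    exact ⟨key x₁ c hx₁ fun j => ⟨(hends j).2.1, (hends j).2.2.2.1⟩,
      key x₂ c' hx₂ fun j => ⟨(hends j).2.2.1, (hends j).2.2.2.2⟩⟩
  · rintro ⟨h₁, h₂⟩ j
    obtain ⟨hne, hce, hc'e, hca, hc'a⟩ := hends j
    -- the moved edge joins the same two (fixed, distinct) vertices: it is the same edge
    have he : (ρ j.1 g).hom.edgeMap (ε j) = ε j := by
      symm
      refine SemiGraph.edge_unique_of_abuts (hT j.1) hne hce hc'e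
        (c' := (ρ j.1 g).hom.branchMap (c j)) (d' := (ρ j.1 g).hom.branchMap (c' j)) ?_ ?_ hca hc'a ?_ ?_
      · rw [(ρ j.1 g).hom.edgeOf_branchMap, hce]
      · rw [(ρ j.1 g).hom.edgeOf_branchMap, hc'e]
      · rw [(ρ j.1 g).hom.abuts_branchMap (c j) (x₁ j.1) hca, h₁]
      · rw [(ρ j.1 g).hom.abuts_branchMap (c' j) (x₂ j.1) hc'a, h₂]
    exact ⟨he, fun b hb =>
      SemiGraph.branchMap_eq_self_of_fixed (hT j.1).isTree.isAcyclic (ρ j.1 g) hce hca (h₁ j.1) he b hb⟩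

omit [Preorder J] in
/-- Automorphisms are injective on vertices. [cite: MochizukiSemiAnbd2006, Thm 3.7(iii) p.41] -/
theorem act_vertexMap_injective (j : J) (g : Gtp) : Function.Injective (ρ j g).hom.vertexMap := by
  intro a b h
  have := congrArg ((ρ j g⁻¹).hom.vertexMap) h
  rwa [act_inv_act_vertexMap, act_inv_act_vertexMap] at this

/-- **End-point data translate along the action**: if `(x₁, x₂)` are the end-point systems of an
eventual compatible edge system with branches, so are `(g·x₁, g·x₂)` (of the translated edges and
branches). [cite: MochizukiSemiAnbd2006, Thm 3.7(iii) p.41] -/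
theorem exists_ends_translate {x₁ x₂ : ∀ j, (T j).Vertex}
    (hE : ∃ (i : J) (ε : ∀ j : {j : J // i ≤ j}, (T j.1).Edge) (c c' : ∀ j : {j : J // i ≤ j}, (T j.1).Branch),
      ∀ j, x₁ j.1 ≠ x₂ j.1 ∧ (T j.1).edgeOf (c j) = ε j ∧ (T j.1).edgeOf (c' j) = ε j ∧
        (T j.1).abuts (c j) = some (x₁ j.1) ∧ (T j.1).abuts (c' j) = some (x₂ j.1))
    (g : Gtp) :
    ∃ (i : J) (ε : ∀ j : {j : J // i ≤ j}, (T j.1).Edge) (c c' : ∀ j : {j : J // i ≤ j}, (T j.1).Branch),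
      ∀ j, (ρ j.1 g).hom.vertexMap (x₁ j.1) ≠ (ρ j.1 g).hom.vertexMap (x₂ j.1) ∧
        (T j.1).edgeOf (c j) = ε j ∧ (T j.1).edgeOf (c' j) = ε j ∧
        (T j.1).abuts (c j) = some ((ρ j.1 g).hom.vertexMap (x₁ j.1)) ∧
        (T j.1).abuts (c' j) = some ((ρ j.1 g).hom.vertexMap (x₂ j.1)) := by
  obtain ⟨i, ε, c, c', hends⟩ := hE
  refine ⟨i, fun j => (ρ j.1 g).hom.edgeMap (ε j), fun j => (ρ j.1 g).hom.branchMap (c j),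
    fun j => (ρ j.1 g).hom.branchMap (c' j), fun j => ?_⟩
  obtain ⟨hne, hce, hc'e, hca, hc'a⟩ := hends j
  refine ⟨fun h => hne (act_vertexMap_injective T ρ j.1 g h), ?_, ?_, ?_, ?_⟩
  · rw [(ρ j.1 g).hom.edgeOf_branchMap, hce]
  · rw [(ρ j.1 g).hom.edgeOf_branchMap, hc'e]
  · exact (ρ j.1 g).hom.abuts_branchMap (c j) (x₁ j.1) hca
  · exact (ρ j.1 g).hom.abuts_branchMap (c' j) (x₂ j.1) hc'a

/-! ### Conjugates of pair-stabilisers -/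

omit [Preorder J] in
/-- Membership in a conjugate subgroup (t3's `conjSubgroup g K = g K g⁻¹`). [folklore] -/
private theorem mem_conjSubgroup_iff'' {g y : Gtp} {K : Subgroup Gtp} :
    y ∈ conjSubgroup g K ↔ g⁻¹ * y * g ∈ K := by
  constructor
  · rintro ⟨z, hz, rfl⟩
    simpa [MulAut.conj_apply, mul_assoc] using hz
  · intro h
    exact ⟨g⁻¹ * y * g, h, by simp [MulAut.conj_apply, mul_assoc]⟩

omit [Preorder J] in
/-- **The conjugate of the full stabiliser of a pair `(x, y)` is the full stabiliser of `(g·x, g·y)`.**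
[cite: MochizukiSemiAnbd2006, Thm 5.4 (i), p. 66] -/
theorem mem_conjSubgroup_pairStabilizer_iff {S : Subgroup Gtp} {x y : ∀ j, (T j).Vertex}
    (hS : ∀ z : Gtp, z ∈ S ↔ (∀ j, (ρ j z).hom.vertexMap (x j) = x j) ∧
      ∀ j, (ρ j z).hom.vertexMap (y j) = y j) (g z : Gtp) :
    z ∈ conjSubgroup g S ↔
      (∀ j, (ρ j z).hom.vertexMap ((ρ j g).hom.vertexMap (x j)) = (ρ j g).hom.vertexMap (x j)) ∧
      ∀ j, (ρ j z).hom.vertexMap ((ρ j g).hom.vertexMap (y j)) = (ρ j g).hom.vertexMap (y j) := by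
  rw [mem_conjSubgroup_iff'', hS]
  have key : ∀ (w : ∀ j, (T j).Vertex) (j : J),
      (ρ j (g⁻¹ * z * g)).hom.vertexMap (w j) = w j ↔
        (ρ j z).hom.vertexMap ((ρ j g).hom.vertexMap (w j)) = (ρ j g).hom.vertexMap (w j) := by
    intro w j
    rw [act_mul_vertexMap, act_mul_vertexMap]
    constructor
    · intro h
      have := congrArg ((ρ j g).hom.vertexMap) h
      rwa [act_act_inv_vertexMap] at this
    · intro h
      rw [h, act_inv_act_vertexMap]
  exact and_congr (forall_congr' (key x)) (forall_congr' (key y))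

end Generic

/-! ### The fields (AI3) `edgeFix` / `edge` of the arithmetic level data, for the produced data -/

namespace ProfiniteSemiGraph

variable {𝒢 : ProfiniteSemiGraph.{u}} {c : TemperedPiChart 𝒢} {Gtp : Type u'} [Group Gtp]
  (ι : c.G →* Gtp) {J : Type v} [Preorder J] (T : J → SemiGraph.{w}) (ρ : ∀ j, Gtp →* Aut (T j))
  (f : ∀ ⦃i j : J⦄, i ≤ j → (T j ⟶ T i))

/-- **Field (AI3) `edgeFix` of `ArithLevelData`, for the PRODUCED data** (Thm 5.4 (i) p. 66 via Thm 3.7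
(iii) p. 41): every edge-like subgroup of `decompositionDataOfChart R ι` — a conjugate
`g₀ · Π^temp_{𝔊,b} · g₀⁻¹`, `b` abutting to `v` in the graph `𝔾` — IS the full stabiliser of an eventual
compatible system of tree edges with their branches, given with its two end-point systems (the
translates `g₀·X v`, `g₀·Y b` of the reference pro-branch of `R.Hb b`).  Over `mem_arithBrGp_iff_fixes_pair`;
all inputs geometric (restricted action) as listed in the module docstring.
[cite: MochizukiSemiAnbd2006, Thm 5.4 (i), p. 66] -/
theorem edgeFix_decompositionDataOfChart [IsDirectedOrder J] (h𝒢 : 𝒢.Thm37Hypotheses)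
    (hG : 𝒢.graph.IsGraph) (R : ChartRepresentatives c) (hι : Function.Injective ι)
    (hnorm : (ι.range).Normal) (hT : ∀ j, (T j).IsTree)
    (hequiv : ∀ ⦃i j : J⦄ (h : i ≤ j) (g : Gtp) (z : (T j).Vertex),
      (f h).vertexMap ((ρ j g).hom.vertexMap z) = (ρ i g).hom.vertexMap ((f h).vertexMap z))
    (hstabN : ∀ x : ∀ j, (T j).Vertex, (∀ ⦃i j : J⦄ (h : i ≤ j), (f h).vertexMap (x j) = x i) →
      ∃ (v : 𝒢.graph.Vertex) (H : Subgroup c.G), H ∈ verticialSubgroups c v ∧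
        ∀ n : c.G, n ∈ H ↔ ∀ j, (ρ j (ι n)).hom.vertexMap (x j) = x j)
    (huniqN : ∀ (v : 𝒢.graph.Vertex) (H : Subgroup c.G), H ∈ verticialSubgroups c v →
      ∀ x x' : ∀ j, (T j).Vertex,
      (∀ ⦃i j : J⦄ (h : i ≤ j), (f h).vertexMap (x j) = x i) →
      (∀ ⦃i j : J⦄ (h : i ≤ j), (f h).vertexMap (x' j) = x' i) →
      (∀ n ∈ H, ∀ j, (ρ j (ι n)).hom.vertexMap (x j) = x j) →
      (∀ n ∈ H, ∀ j, (ρ j (ι n)).hom.vertexMap (x' j) = x' j) → x = x')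
    (Adj : (∀ j, (T j).Vertex) → (∀ j, (T j).Vertex) → Prop)
    (hAdj : ∀ (x y : ∀ j, (T j).Vertex) (g : Gtp), Adj x y →
      Adj (fun j => (ρ j g).hom.vertexMap (x j)) (fun j => (ρ j g).hom.vertexMap (y j)))
    (hAdjEnds : ∀ x y : ∀ j, (T j).Vertex, Adj x y →
      ∃ (i : J) (ε : ∀ j : {j : J // i ≤ j}, (T j.1).Edge) (c c' : ∀ j : {j : J // i ≤ j}, (T j.1).Branch),
        ∀ j, x j.1 ≠ y j.1 ∧ (T j.1).edgeOf (c j) = ε j ∧ (T j.1).edgeOf (c' j) = ε j ∧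
          (T j.1).abuts (c j) = some (x j.1) ∧ (T j.1).abuts (c' j) = some (y j.1))
    (hEstabN : ∀ x y : ∀ j, (T j).Vertex, (∀ ⦃i j : J⦄ (h : i ≤ j), (f h).vertexMap (x j) = x i) →
      (∀ ⦃i j : J⦄ (h : i ≤ j), (f h).vertexMap (y j) = y i) → Adj x y →
      ∃ (e : 𝒢.graph.Edge) (K : Subgroup c.G), K ∈ edgeLikeSubgroups c e ∧
        ∀ n : c.G, n ∈ K ↔ (∀ j, (ρ j (ι n)).hom.vertexMap (x j) = x j) ∧
          ∀ j, (ρ j (ι n)).hom.vertexMap (y j) = y j)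
    (hErigid : ∀ (v : 𝒢.graph.Vertex) (H : Subgroup c.G), H ∈ verticialSubgroups c v →
      ∀ (e e' : 𝒢.graph.Edge) (K K' : Subgroup c.G), K ∈ edgeLikeSubgroups c e →
        K' ∈ edgeLikeSubgroups c e' → K ≤ H → K' ≤ H → Subgroup.Commensurable K K' → K = K')
    (hEinj : ∀ x y y' : ∀ j, (T j).Vertex, (∀ ⦃i j : J⦄ (h : i ≤ j), (f h).vertexMap (x j) = x i) →
      (∀ ⦃i j : J⦄ (h : i ≤ j), (f h).vertexMap (y j) = y i) →
      (∀ ⦃i j : J⦄ (h : i ≤ j), (f h).vertexMap (y' j) = y' i) → Adj x y → Adj x y' →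
      (∀ n : c.G, ((∀ j, (ρ j (ι n)).hom.vertexMap (x j) = x j) ∧
          ∀ j, (ρ j (ι n)).hom.vertexMap (y j) = y j) ↔
        ((∀ j, (ρ j (ι n)).hom.vertexMap (x j) = x j) ∧
          ∀ j, (ρ j (ι n)).hom.vertexMap (y' j) = y' j)) → y = y')
    (X : 𝒢.graph.Vertex → ∀ j, (T j).Vertex) (Y : 𝒢.graph.Branch → ∀ j, (T j).Vertex)
    (hX : ∀ v, (∀ ⦃i j : J⦄ (h : i ≤ j), (f h).vertexMap (X v j) = X v i) ∧
      ∀ n : c.G, n ∈ R.Hv v ↔ ∀ j, (ρ j (ι n)).hom.vertexMap (X v j) = X v j)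
    (hY : ∀ (b : 𝒢.graph.Branch) (v : 𝒢.graph.Vertex), 𝒢.graph.abuts b = some v →
      (∀ ⦃i j : J⦄ (h : i ≤ j), (f h).vertexMap (Y b j) = Y b i) ∧ Adj (X v) (Y b) ∧
      ∀ n : c.G, n ∈ R.Hb b ↔ (∀ j, (ρ j (ι n)).hom.vertexMap (X v j) = X v j) ∧
        ∀ j, (ρ j (ι n)).hom.vertexMap (Y b j) = Y b j)
    (L : Subgroup Gtp) (hL : IsEdgeLike (decompositionDataOfChart R ι) L) :
    ∃ (i : J) (ε : ∀ j : {j : J // i ≤ j}, (T j.1).Edge) (c c' : ∀ j : {j : J // i ≤ j}, (T j.1).Branch)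
      (x₁ x₂ : ∀ j, (T j).Vertex),
      (∀ ⦃i' j : J⦄ (h : i' ≤ j), (f h).vertexMap (x₁ j) = x₁ i') ∧
      (∀ ⦃i' j : J⦄ (h : i' ≤ j), (f h).vertexMap (x₂ j) = x₂ i') ∧
      (∀ j, x₁ j.1 ≠ x₂ j.1 ∧ (T j.1).edgeOf (c j) = ε j ∧ (T j.1).edgeOf (c' j) = ε j ∧
        (T j.1).abuts (c j) = some (x₁ j.1) ∧ (T j.1).abuts (c' j) = some (x₂ j.1)) ∧
      ∀ g : Gtp, g ∈ L ↔ ∀ j, (ρ j.1 g).hom.edgeMap (ε j) = ε j ∧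
        ∀ b : (T j.1).Branch, (T j.1).edgeOf b = ε j → (ρ j.1 g).hom.branchMap b = b := by
  obtain ⟨b, g₀, rfl⟩ := hL
  obtain ⟨v, hb⟩ := Option.isSome_iff_exists.mp (hG.abuts_isSome b)
  obtain ⟨hXc, hXv⟩ := hX v
  obtain ⟨hYc, hXY, hYb⟩ := hY b v hb
  -- `Π^temp_{𝔊,b}` is the stabiliser of the reference pair `(X v, Y b)`
  have hS : ∀ z : Gtp, z ∈ arithBrGp R ι b ↔ (∀ j, (ρ j z).hom.vertexMap (X v j) = X v j) ∧
      ∀ j, (ρ j z).hom.vertexMap (Y b j) = Y b j :=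
    mem_arithBrGp_iff_fixes_pair ι T ρ f h𝒢 R hι hnorm hequiv hstabN huniqN Adj hAdj hEstabN hErigid
      hEinj hb hXc hYc hXY hXv hYb
  -- the translated pair and its end-point data
  obtain ⟨i, ε, cc, cc', hends⟩ := hAdjEnds _ _ (hAdj (X v) (Y b) g₀ hXY)
  refine ⟨i, ε, cc, cc', fun j => (ρ j g₀).hom.vertexMap (X v j), fun j => (ρ j g₀).hom.vertexMap (Y b j),
    compatible_translate T ρ f hequiv hXc g₀, compatible_translate T ρ f hequiv hYc g₀, hends, fun g => ?_⟩
  rw [decompositionDataOfChart_brGp, mem_conjSubgroup_pairStabilizer_iff T ρ hS g₀ g]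
  exact (edgeSystem_fixed_iff_ends_fixed T ρ f hT hequiv (compatible_translate T ρ f hequiv hXc g₀)
    (compatible_translate T ρ f hequiv hYc g₀) hends g).symm

/-- **Field (AI3) `edge` of `ArithLevelData`, for the PRODUCED data, for edge systems given with their
end-point data** (Thm 5.4 (i) p. 66 via Thm 3.7 (iii) p. 41): the full stabiliser of an eventual
compatible system of tree edges with branches and end-point systems `(x₁, x₂)` IS an edge-like subgroup of
`decompositionDataOfChart R ι`: by transitivity of `Π^temp_𝔾` on the pro-branches above a branch of `𝔾`
(`hEtrans`) the pair `(x₁, x₂)` is a translate `n·(X v, Y b)` (in some order) of a reference pro-branch,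
and the stabiliser is `ι(n) · Π^temp_{𝔊,b} · ι(n)⁻¹`. [cite: MochizukiSemiAnbd2006, Thm 5.4 (i), p. 66] -/
theorem edge_decompositionDataOfChart_of_ends [IsDirectedOrder J] (h𝒢 : 𝒢.Thm37Hypotheses)
    (R : ChartRepresentatives c) (hι : Function.Injective ι) (hnorm : (ι.range).Normal)
    (hT : ∀ j, (T j).IsTree)
    (hequiv : ∀ ⦃i j : J⦄ (h : i ≤ j) (g : Gtp) (z : (T j).Vertex),
      (f h).vertexMap ((ρ j g).hom.vertexMap z) = (ρ i g).hom.vertexMap ((f h).vertexMap z))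
    (hstabN : ∀ x : ∀ j, (T j).Vertex, (∀ ⦃i j : J⦄ (h : i ≤ j), (f h).vertexMap (x j) = x i) →
      ∃ (v : 𝒢.graph.Vertex) (H : Subgroup c.G), H ∈ verticialSubgroups c v ∧
        ∀ n : c.G, n ∈ H ↔ ∀ j, (ρ j (ι n)).hom.vertexMap (x j) = x j)
    (huniqN : ∀ (v : 𝒢.graph.Vertex) (H : Subgroup c.G), H ∈ verticialSubgroups c v →
      ∀ x x' : ∀ j, (T j).Vertex,
      (∀ ⦃i j : J⦄ (h : i ≤ j), (f h).vertexMap (x j) = x i) →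
      (∀ ⦃i j : J⦄ (h : i ≤ j), (f h).vertexMap (x' j) = x' i) →
      (∀ n ∈ H, ∀ j, (ρ j (ι n)).hom.vertexMap (x j) = x j) →
      (∀ n ∈ H, ∀ j, (ρ j (ι n)).hom.vertexMap (x' j) = x' j) → x = x')
    (Adj : (∀ j, (T j).Vertex) → (∀ j, (T j).Vertex) → Prop)
    (hAdj : ∀ (x y : ∀ j, (T j).Vertex) (g : Gtp), Adj x y →
      Adj (fun j => (ρ j g).hom.vertexMap (x j)) (fun j => (ρ j g).hom.vertexMap (y j)))
    (hEndsAdj : ∀ x y : ∀ j, (T j).Vertex,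
      (∃ (i : J) (ε : ∀ j : {j : J // i ≤ j}, (T j.1).Edge) (c c' : ∀ j : {j : J // i ≤ j}, (T j.1).Branch),
        ∀ j, x j.1 ≠ y j.1 ∧ (T j.1).edgeOf (c j) = ε j ∧ (T j.1).edgeOf (c' j) = ε j ∧
          (T j.1).abuts (c j) = some (x j.1) ∧ (T j.1).abuts (c' j) = some (y j.1)) → Adj x y)
    (hEstabN : ∀ x y : ∀ j, (T j).Vertex, (∀ ⦃i j : J⦄ (h : i ≤ j), (f h).vertexMap (x j) = x i) →
      (∀ ⦃i j : J⦄ (h : i ≤ j), (f h).vertexMap (y j) = y i) → Adj x y →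
      ∃ (e : 𝒢.graph.Edge) (K : Subgroup c.G), K ∈ edgeLikeSubgroups c e ∧
        ∀ n : c.G, n ∈ K ↔ (∀ j, (ρ j (ι n)).hom.vertexMap (x j) = x j) ∧
          ∀ j, (ρ j (ι n)).hom.vertexMap (y j) = y j)
    (hErigid : ∀ (v : 𝒢.graph.Vertex) (H : Subgroup c.G), H ∈ verticialSubgroups c v →
      ∀ (e e' : 𝒢.graph.Edge) (K K' : Subgroup c.G), K ∈ edgeLikeSubgroups c e →
        K' ∈ edgeLikeSubgroups c e' → K ≤ H → K' ≤ H → Subgroup.Commensurable K K' → K = K')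
    (hEinj : ∀ x y y' : ∀ j, (T j).Vertex, (∀ ⦃i j : J⦄ (h : i ≤ j), (f h).vertexMap (x j) = x i) →
      (∀ ⦃i j : J⦄ (h : i ≤ j), (f h).vertexMap (y j) = y i) →
      (∀ ⦃i j : J⦄ (h : i ≤ j), (f h).vertexMap (y' j) = y' i) → Adj x y → Adj x y' →
      (∀ n : c.G, ((∀ j, (ρ j (ι n)).hom.vertexMap (x j) = x j) ∧
          ∀ j, (ρ j (ι n)).hom.vertexMap (y j) = y j) ↔
        ((∀ j, (ρ j (ι n)).hom.vertexMap (x j) = x j) ∧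
          ∀ j, (ρ j (ι n)).hom.vertexMap (y' j) = y' j)) → y = y')
    (X : 𝒢.graph.Vertex → ∀ j, (T j).Vertex) (Y : 𝒢.graph.Branch → ∀ j, (T j).Vertex)
    (hX : ∀ v, (∀ ⦃i j : J⦄ (h : i ≤ j), (f h).vertexMap (X v j) = X v i) ∧
      ∀ n : c.G, n ∈ R.Hv v ↔ ∀ j, (ρ j (ι n)).hom.vertexMap (X v j) = X v j)
    (hY : ∀ (b : 𝒢.graph.Branch) (v : 𝒢.graph.Vertex), 𝒢.graph.abuts b = some v →
      (∀ ⦃i j : J⦄ (h : i ≤ j), (f h).vertexMap (Y b j) = Y b i) ∧ Adj (X v) (Y b) ∧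
      ∀ n : c.G, n ∈ R.Hb b ↔ (∀ j, (ρ j (ι n)).hom.vertexMap (X v j) = X v j) ∧
        ∀ j, (ρ j (ι n)).hom.vertexMap (Y b j) = Y b j)
    (hEtrans : ∀ x₁ x₂ : ∀ j, (T j).Vertex, (∀ ⦃i j : J⦄ (h : i ≤ j), (f h).vertexMap (x₁ j) = x₁ i) →
      (∀ ⦃i j : J⦄ (h : i ≤ j), (f h).vertexMap (x₂ j) = x₂ i) → Adj x₁ x₂ →
      ∃ (b : 𝒢.graph.Branch) (v : 𝒢.graph.Vertex) (_ : 𝒢.graph.abuts b = some v) (n : c.G),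
        ((fun j => (ρ j (ι n)).hom.vertexMap (X v j)) = x₁ ∧
            (fun j => (ρ j (ι n)).hom.vertexMap (Y b j)) = x₂) ∨
          ((fun j => (ρ j (ι n)).hom.vertexMap (X v j)) = x₂ ∧
            (fun j => (ρ j (ι n)).hom.vertexMap (Y b j)) = x₁))
    {i : J} (ε : ∀ j : {j : J // i ≤ j}, (T j.1).Edge) (c c' : ∀ j : {j : J // i ≤ j}, (T j.1).Branch)
    (x₁ x₂ : ∀ j, (T j).Vertex)
    (hx₁ : ∀ ⦃i' j : J⦄ (h : i' ≤ j), (f h).vertexMap (x₁ j) = x₁ i')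
    (hx₂ : ∀ ⦃i' j : J⦄ (h : i' ≤ j), (f h).vertexMap (x₂ j) = x₂ i')
    (hends : ∀ j, x₁ j.1 ≠ x₂ j.1 ∧ (T j.1).edgeOf (c j) = ε j ∧ (T j.1).edgeOf (c' j) = ε j ∧
      (T j.1).abuts (c j) = some (x₁ j.1) ∧ (T j.1).abuts (c' j) = some (x₂ j.1)) :
    ∃ L : Subgroup Gtp, IsEdgeLike (decompositionDataOfChart R ι) L ∧
      ∀ g : Gtp, g ∈ L ↔ ∀ j, (ρ j.1 g).hom.edgeMap (ε j) = ε j ∧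
        ∀ b : (T j.1).Branch, (T j.1).edgeOf b = ε j → (ρ j.1 g).hom.branchMap b = b := by
  -- the pair `(x₁, x₂)` is a translate of a reference pro-branch `(X v, Y b)`
  have hxy : Adj x₁ x₂ := hEndsAdj x₁ x₂ ⟨i, ε, c, c', hends⟩
  obtain ⟨b, v, hb, n, hn⟩ := hEtrans x₁ x₂ hx₁ hx₂ hxy
  obtain ⟨hXc, hXv⟩ := hX v
  obtain ⟨hYc, hXY, hYb⟩ := hY b v hb
  have hS : ∀ z : Gtp, z ∈ arithBrGp R ι b ↔ (∀ j, (ρ j z).hom.vertexMap (X v j) = X v j) ∧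
      ∀ j, (ρ j z).hom.vertexMap (Y b j) = Y b j :=
    mem_arithBrGp_iff_fixes_pair ι T ρ f h𝒢 R hι hnorm hequiv hstabN huniqN Adj hAdj hEstabN hErigid
      hEinj hb hXc hYc hXY hXv hYb
  refine ⟨conjSubgroup (ι n) (arithBrGp R ι b), ⟨b, ι n, by rw [decompositionDataOfChart_brGp]⟩,
    fun g => ?_⟩
  rw [mem_conjSubgroup_pairStabilizer_iff T ρ hS (ι n) g,
    edgeSystem_fixed_iff_ends_fixed T ρ f hT hequiv hx₁ hx₂ hends g]
  rcases hn with ⟨h₁, h₂⟩ | ⟨h₁, h₂⟩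
  · rw [← h₁, ← h₂]
  · rw [← h₁, ← h₂, and_comm]

end ProfiniteSemiGraph

end Literature.AnabelianGeometry.SemiGraphs
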